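import Literature.Probability.RandomPlanarGeometry.LoewnerThrChainDeriv
import HarnessLib

/-!
# The through-swallow image flow solves Loewner's equation driven by `U* ∘ σ⁻¹`

Topic `Probability/RandomPlanarGeometry`; theorems only (crux `stmt-CriticalPhenomena-0698`, stub
`stub_isLocal`, through-swallow image chain of the locality of SLE₆: G. F. Lawler (2005), §6.3
Thm. 6.13 — `Φ_t = g*_t ∘ Φ ∘ g_t⁻¹` with `g*` the Loewner chain of the image, followed THROUGH the
instants at which the hull swallows whole pieces of `A`; Prop. 4.41; Lawler–Schramm–Werner (2003),
§5). Sequel of `LoewnerThrChainDeriv`: on a horizon `[0, β]` on which the remaining hull is closed and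
takes finitely many values, for `z ∈ ℍ ∖ A` alive at `β`,

* `hasDerivAt_of_hasDerivAt_of_ne_nhds` — a real function with derivative `g` on a punctured
  neighbourhood of `x`, continuous at `x` together with `g`, has derivative `g x` at `x`
  (local form of Mathlib's `hasDerivAt_of_hasDerivAt_of_ne`);
* **`hasDerivAt_thrImageFlowC`** — `∂_q g̃_{τ q}(ζ) = 2/(g̃_{τ q}(ζ) − U*_{τ q})` at EVERY `q ∈ (0, σβ)`:
  at the finitely many capacity images of the jump times the flow and the field are continuous
  (`LoewnerThrFlow`) and the derivative extends across;
* `hasDerivWithinAt_thrImageFlowC_zero`, **`isSolution_thrImageFlowC`** — the flow in capacity time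
  is a `Loewner.IsSolution` of the chain driven by `thrImageDriverC W A β` started at `g̃_0(ζ) = E_A(z)`
  with lifetime `σβ`;
* **`map_thrImageDriverC_eq`** — hence `Loewner.map (U* ∘ τ) q (g̃_0 ζ) = g̃_{τ q}(ζ)` for `q < σβ`: the
  through-swallow image maps ARE the Loewner maps of the image driving function in capacity time;
  `le_swallowingTime_thrImageDriverC`, `thrImageFlow_zero_mem_domain`.
-/

noncomputable section

open Set Filter Topology Function Complex Metric MeasureTheory intervalIntegral
open UpperHalfPlane (upperHalfPlaneSet)
open scoped NNReal

namespace Literature.Probability.RandomPlanarGeometry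

namespace Loewner

variable {W : ℝ≥0 → ℝ} {A : Set ℂ}

/-! ### Extension of a derivative across an isolated point -/

omit W A in
/-- **A derivative extends across an isolated point of continuity**: if `f` has derivative `g y` at
every `y ≠ x` near `x` and `f`, `g` are continuous at `x`, then `HasDerivAt f (g x) x` (one-sided
extension `hasDerivWithinAt_Ici/Iic_of_tendsto_deriv` on both sides). [folklore] -/
theorem hasDerivAt_of_hasDerivAt_of_ne_nhds {E : Type*} [NormedAddCommGroup E] [NormedSpace ℝ E]
    {f g : ℝ → E} {x : ℝ} (hd : ∀ᶠ y in 𝓝[≠] x, HasDerivAt f (g y) y) (hf : ContinuousAt f x)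
    (hg : ContinuousAt g x) : HasDerivAt f (g x) x := by
  obtain ⟨ε, hε, hε'⟩ := Metric.eventually_nhds_iff.1 (eventually_nhdsWithin_iff.1 hd)
  have hd' : ∀ y, dist y x < ε → y ≠ x → HasDerivAt f (g y) y := fun y hy hne ↦ hε' hy hne
  have hA : HasDerivWithinAt f (g x) (Ici x) x := by
    have hs : Ioo x (x + ε) ∈ 𝓝[>] x := Ioo_mem_nhdsGT (lt_add_of_pos_right x hε)
    have hmem : ∀ y ∈ Ioo x (x + ε), dist y x < ε ∧ y ≠ x := fun y hy ↦
      ⟨by rw [Real.dist_eq, abs_of_pos (sub_pos.2 hy.1)]; linarith [hy.2], ne_of_gt hy.1⟩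
    have diff : DifferentiableOn ℝ f (Ioo x (x + ε)) := fun y hy ↦
      (hd' y (hmem y hy).1 (hmem y hy).2).differentiableAt.differentiableWithinAt
    refine hasDerivWithinAt_Ici_of_tendsto_deriv diff hf.continuousWithinAt hs ?_
    have : Tendsto g (𝓝[>] x) (𝓝 (g x)) := tendsto_inf_left hg
    refine this.congr' ?_
    filter_upwards [hs] with y hy
    exact ((hd' y (hmem y hy).1 (hmem y hy).2).deriv).symm
  have hB : HasDerivWithinAt f (g x) (Iic x) x := by
    have hs : Ioo (x - ε) x ∈ 𝓝[<] x := Ioo_mem_nhdsLT (sub_lt_self x hε)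
    have hmem : ∀ y ∈ Ioo (x - ε) x, dist y x < ε ∧ y ≠ x := fun y hy ↦
      ⟨by rw [Real.dist_eq, abs_of_neg (sub_neg.2 hy.2)]; linarith [hy.1], ne_of_lt hy.2⟩
    have diff : DifferentiableOn ℝ f (Ioo (x - ε) x) := fun y hy ↦
      (hd' y (hmem y hy).1 (hmem y hy).2).differentiableAt.differentiableWithinAt
    refine hasDerivWithinAt_Iic_of_tendsto_deriv diff hf.continuousWithinAt hs ?_
    have : Tendsto g (𝓝[<] x) (𝓝 (g x)) := tendsto_inf_left hg
    refine this.congr' ?_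
    filter_upwards [hs] with y hy
    exact ((hd' y (hmem y hy).1 (hmem y hy).2).deriv).symm
  simpa using hB.union hA

section Chain

variable (hW : Continuous W) (hW0 : W 0 = 0) (hA : IsStarHull A) {β : ℝ≥0}
  (hcl : ∀ t ≤ β, IsClosed (remHull W A t)) (hfin : (remHull W A '' Icc 0 β).Finite)
  {z : ℂ} (hzH : 0 < z.im) (hzA : z ∉ A) (hzβ : (β : WithTop ℝ≥0) < swallowingTime W z)
include hW hW0 hA hcl hfin hzH hzA hzβ

/-! ### The Loewner equation in capacity time, through the instants -/

/-- **`∂_q g̃_{τ q}(ζ) = 2/(g̃_{τ q}(ζ) − U*_{τ q})` at every `q ∈ (0, σβ)`.** Off the finite set of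
capacity images of the jump times the original time `τ q` is regular
(`hasDerivAt_thrImageFlowC_of_regular`); at the exceptional points the flow and the field are
continuous and the derivative extends (`hasDerivAt_of_hasDerivAt_of_ne_nhds`).
[cite: Lawler2005, §6.3 Thm. 6.13 with Prop. 4.41; LawlerSchrammWerner2003Restriction, §5 (5.1)] -/
theorem hasDerivAt_thrImageFlowC {q : ℝ} (hq : q ∈ Ioo (0 : ℝ) (thrClock W A β)) :
    HasDerivAt (thrImageFlowC W A β z)
      (2 / (thrImageFlowC W A β z q - thrImageDriver W A (thrClockInv W A β q).toNNReal)) q := by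
  have hint := integrableOn_thrClockRate hW hA hcl hfin
  set S := thrClock W A β with hSdef
  set Fld : ℝ → ℂ := fun y ↦
    2 / (thrImageFlowC W A β z y - thrImageDriver W A (thrClockInv W A β y).toNNReal) with hFld
  -- the finite exceptional set of capacity times
  set J : Set ℝ≥0 := {s : ℝ≥0 | s ≤ β ∧ ∀ s₀ < s, ∃ r ∈ Ico s₀ s, remHull W A r ≠ remHull W A s} with hJ
  have hJfin : J.Finite := finite_setOf_isJump hfin
  set Q : Set ℝ := (fun s : ℝ≥0 ↦ thrClock W A s) '' J with hQdef
  have hQfin : Q.Finite := hJfin.image _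
  -- the derivative at non-exceptional capacity times
  have hreg : ∀ y ∈ Ioo (0 : ℝ) S, y ∉ Q → HasDerivAt (thrImageFlowC W A β z) (Fld y) y := by
    intro y hy hyQ
    obtain ⟨hτy, hστ⟩ := thrClockInv_spec hint ⟨hy.1.le, hy.2.le⟩
    set sN : ℝ≥0 := (thrClockInv W A β y).toNNReal with hsNdef
    have hsN : (sN : ℝ) = thrClockInv W A β y := Real.coe_toNNReal _ hτy.1
    have hτlt : thrClockInv W A β y < β := by
      have := strictMonoOn_thrClockInv hint ⟨hy.1.le, hy.2.le⟩ ⟨hy.1.le.trans hy.2.le, le_rfl⟩ hy.2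
      rwa [thrClockInv_thrClock hint ⟨β.coe_nonneg, le_rfl⟩] at this
    have hsNlt : sN < β := by rw [← NNReal.coe_lt_coe, hsN]; exact hτlt
    -- `sN` is not a jump time (else `y = σ sN ∈ Q`)
    have hnoj : ∃ s₀ < sN, ∀ r ∈ Ico s₀ sN, remHull W A r = remHull W A sN := by
      by_contra h
      apply hyQ
      refine ⟨sN, ⟨hsNlt.le, fun s₀ hs₀ ↦ ?_⟩, ?_⟩
      · by_contra h'
        exact h ⟨s₀, hs₀, fun r hr ↦ by
          by_contra hne
          exact h' ⟨r, hr, hne⟩⟩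
      · show thrClock W A (sN : ℝ) = y
        rw [hsN, hστ]
    obtain ⟨s₀, s₁, hs₀, hs₁, hs₁β, hconst⟩ := exists_nhds_remHull_eq hA hfin hsNlt hnoj
    refine hasDerivAt_thrImageFlowC_of_regular hW hA hcl hfin hzH hzA hzβ hy ?_ ?_ hs₁β hconst
    · rw [← hsN]; exact NNReal.coe_lt_coe.2 hs₀
    · rw [← hsN]; exact NNReal.coe_lt_coe.2 hs₁
  -- continuity of the flow and of the field at `q`
  obtain ⟨hGc, hUc⟩ := continuousOn_thrImageFlowC hW hW0 hA hcl hfin hzH hzA hzβ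
  have hnhds : Icc (0 : ℝ) S ∈ 𝓝 q := Icc_mem_nhds hq.1 hq.2
  have hGq : ContinuousAt (thrImageFlowC W A β z) q := (hGc q ⟨hq.1.le, hq.2.le⟩).continuousAt hnhds
  have hFq : ContinuousAt Fld q := by
    have hne : thrImageFlowC W A β z q - (thrImageDriver W A (thrClockInv W A β q).toNNReal : ℂ) ≠ 0 := by
      intro h0
      have := im_thrImageFlowC_sub_pos hW hA hcl hzH hzA hzβ hint ⟨hq.1.le, hq.2.le⟩
      rw [h0, zero_im] at this
      exact lt_irrefl _ this
    exact continuousAt_const.div (hGq.sub ((hUc q ⟨hq.1.le, hq.2.le⟩).continuousAt hnhds)) hne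
  -- off the finite set near `q`
  have hQ' : (Q \ {q})ᶜ ∈ 𝓝 q :=
    (hQfin.subset Set.sdiff_subset).isClosed.isOpen_compl.mem_nhds fun h ↦ h.2 rfl
  refine hasDerivAt_of_hasDerivAt_of_ne_nhds ?_ hGq hFq
  rw [eventually_nhdsWithin_iff]
  filter_upwards [Ioo_mem_nhds hq.1 hq.2, hQ'] with y hy hyQ hne
  exact hreg y hy fun h ↦ hyQ ⟨h, hne⟩

/-- **The right derivative at `q = 0`**: `2/(g̃_0(ζ) − U*_0)` within `[0, ∞)` (`σβ > 0`), by extension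
of the interior derivative. [folklore] -/
theorem hasDerivWithinAt_thrImageFlowC_zero (hS : 0 < thrClock W A β) :
    HasDerivWithinAt (thrImageFlowC W A β z)
      (2 / (thrImageFlowC W A β z 0 - thrImageDriver W A (thrClockInv W A β 0).toNNReal)) (Ici (0 : ℝ)) 0 := by
  have hint := integrableOn_thrClockRate hW hA hcl hfin
  set S := thrClock W A β with hSdef
  obtain ⟨hGc, hWc⟩ := continuousOn_thrImageFlowC hW hW0 hA hcl hfin hzH hzA hzβ
  set F : ℝ → ℂ := fun q ↦ 2 / (thrImageFlowC W A β z q - thrImageDriver W A (thrClockInv W A β q).toNNReal)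
    with hF
  have hFc : ContinuousOn F (Icc (0 : ℝ) S) := by
    refine continuousOn_const.div (hGc.sub hWc) fun q hq h0 ↦ ?_
    have := im_thrImageFlowC_sub_pos hW hA hcl hzH hzA hzβ hint hq
    rw [h0, zero_im] at this
    exact lt_irrefl _ this
  have hderiv : ∀ q ∈ Ioo (0 : ℝ) S, HasDerivAt (thrImageFlowC W A β z) (F q) q := fun q hq ↦
    hasDerivAt_thrImageFlowC hW hW0 hA hcl hfin hzH hzA hzβ hq
  have hdiff : DifferentiableOn ℝ (thrImageFlowC W A β z) (Ioo (0 : ℝ) S) := fun q hq ↦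
    (hderiv q hq).differentiableAt.differentiableWithinAt
  have hmem : Ioo (0 : ℝ) S ∈ 𝓝[>] (0 : ℝ) := Ioo_mem_nhdsGT hS
  have hcont : ContinuousWithinAt (thrImageFlowC W A β z) (Ioo (0 : ℝ) S) 0 :=
    (hGc 0 ⟨le_rfl, hS.le⟩).mono Ioo_subset_Icc_self
  have hlim : Tendsto (fun q ↦ deriv (thrImageFlowC W A β z) q) (𝓝[>] (0 : ℝ)) (𝓝 (F 0)) := by
    have h1 : Tendsto F (𝓝[>] (0 : ℝ)) (𝓝 (F 0)) :=
      (hFc 0 ⟨le_rfl, hS.le⟩).tendsto.mono_left (by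
        rw [nhdsWithin_Icc_eq_nhdsGE hS]; exact nhdsWithin_mono _ Ioi_subset_Ici_self)
    refine h1.congr' ?_
    filter_upwards [hmem] with q hq
    exact ((hderiv q hq).deriv).symm
  exact hasDerivWithinAt_Ici_of_tendsto_deriv hdiff hcont hmem hlim

/-- **The through-swallow image flow in capacity time solves Loewner's equation driven by `U* ∘ τ`**
with lifetime `σβ`: `Loewner.IsSolution (thrImageDriverC W A β) (g̃_0 ζ) (thrImageFlowC W A β z) (σβ)`.
[cite: Lawler2005, §6.3 Thm. 6.13 (g* is the Loewner chain of the image) with Prop. 4.41; LawlerSchrammWerner2003Restriction, §5] -/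
theorem isSolution_thrImageFlowC :
    IsSolution (thrImageDriverC W A β) (thrImageFlow W A 0 z) (thrImageFlowC W A β z)
      ((thrClock W A β).toNNReal : WithTop ℝ≥0) := by
  have hint := integrableOn_thrClockRate hW hA hcl hfin
  set S : ℝ := thrClock W A β with hSdef
  have hS0 : 0 ≤ S := (thrClock_mem hint ⟨β.coe_nonneg, le_rfl⟩).1
  have hset : ∀ {t : ℝ}, (0 ≤ t ∧ ((t.toNNReal : WithTop ℝ≥0) < (S.toNNReal : WithTop ℝ≥0))) ↔ t ∈ Ico (0 : ℝ) S := by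
    intro t
    constructor
    · rintro ⟨ht0, ht⟩
      refine ⟨ht0, ?_⟩
      have := WithTop.coe_lt_coe.1 ht
      rwa [← NNReal.coe_lt_coe, Real.coe_toNNReal t ht0, Real.coe_toNNReal S hS0] at this
    · rintro ⟨ht0, ht⟩
      refine ⟨ht0, WithTop.coe_lt_coe.2 ?_⟩
      rwa [← NNReal.coe_lt_coe, Real.coe_toNNReal t ht0, Real.coe_toNNReal S hS0]
  refine ⟨thrImageFlowC_zero hint z, fun t ht ↦ ?_, fun t ht0 htS ↦ ?_⟩
  · have htI := hset.1 ht
    have hvf : vectorField (thrImageDriverC W A β) t (thrImageFlowC W A β z t) =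
        2 / (thrImageFlowC W A β z t - thrImageDriver W A (thrClockInv W A β t).toNNReal) := by
      rw [vectorField_apply, thrImageDriverC_toNNReal ⟨htI.1, htI.2.le⟩]
    rw [hvf]
    rcases htI.1.eq_or_lt with h0 | hpos
    · have hS : 0 < S := by have := htI.2; rwa [← h0] at this
      rw [← h0]
      exact (hasDerivWithinAt_thrImageFlowC_zero hW hW0 hA hcl hfin hzH hzA hzβ hS).mono fun u hu ↦ (hset.1 hu).1
    · exact (hasDerivAt_thrImageFlowC hW hW0 hA hcl hfin hzH hzA hzβ ⟨hpos, htI.2⟩).hasDerivWithinAt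
  · have htI := hset.1 ⟨ht0, htS⟩
    rw [thrImageDriverC_toNNReal ⟨htI.1, htI.2.le⟩]
    intro h0
    have := im_thrImageFlowC_sub_pos hW hA hcl hzH hzA hzβ hint ⟨htI.1, htI.2.le⟩
    rw [h0, sub_self, zero_im] at this
    exact lt_irrefl _ this

/-- **The through-swallow image maps are the Loewner maps of the image driving function in capacity
time**: `Loewner.map (U* ∘ τ) q (g̃_0 ζ) = g̃_{τ q}(ζ)` for `0 ≤ q < σβ` (with `W 0 = 0`: `g̃_0 = E_A`,
`thrImageFlow_zero`). [cite: Lawler2005, §6.3 Thm. 6.13 (Φ_t = g*_t ∘ Φ ∘ g_t⁻¹); LawlerSchrammWerner2003Restriction, §5] -/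
theorem map_thrImageDriverC_eq {q : ℝ≥0} (hq : (q : ℝ) < thrClock W A β) :
    map (thrImageDriverC W A β) q (thrImageFlow W A 0 z) = thrImageFlowC W A β z q := by
  have hint := integrableOn_thrClockRate hW hA hcl hfin
  have h := isSolution_thrImageFlowC hW hW0 hA hcl hfin hzH hzA hzβ
  have hS0 : 0 ≤ thrClock W A β := (thrClock_mem hint ⟨β.coe_nonneg, le_rfl⟩).1
  have hq' : (q : WithTop ℝ≥0) < ((thrClock W A β).toNNReal : WithTop ℝ≥0) :=
    WithTop.coe_lt_coe.2 (by rw [← NNReal.coe_lt_coe, Real.coe_toNNReal _ hS0]; exact hq)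
  exact map_eq_of_isSolution (continuous_thrImageDriverC hW hW0 hA hcl hfin) h hq'

/-- **Lifetime lower bound**: the image point `g̃_0(ζ)` of a point `z` alive at `β` is alive under
`U* ∘ τ` at least until the image horizon `σβ`. [folklore] -/
theorem le_swallowingTime_thrImageDriverC :
    ((thrClock W A β).toNNReal : WithTop ℝ≥0) ≤ swallowingTime (thrImageDriverC W A β) (thrImageFlow W A 0 z) :=
  (isSolution_thrImageFlowC hW hW0 hA hcl hfin hzH hzA hzβ).le_swallowingTime

/-- The image point lies in the Loewner domain of `U* ∘ τ` at every capacity time `q < σβ`.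
[folklore] -/
theorem thrImageFlow_zero_mem_domain {q : ℝ≥0} (hq : (q : ℝ) < thrClock W A β)
    (h0 : 0 < (thrImageFlow W A 0 z).im) : thrImageFlow W A 0 z ∈ domain (thrImageDriverC W A β) q := by
  have hint := integrableOn_thrClockRate hW hA hcl hfin
  refine (mem_domain_iff _ q _).2 ⟨h0, lt_of_lt_of_le ?_
    (le_swallowingTime_thrImageDriverC hW hW0 hA hcl hfin hzH hzA hzβ)⟩
  have hS0 : 0 ≤ thrClock W A β := (thrClock_mem hint ⟨β.coe_nonneg, le_rfl⟩).1
  exact WithTop.coe_lt_coe.2 (by rw [← NNReal.coe_lt_coe, Real.coe_toNNReal _ hS0]; exact hq)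

end Chain

end Loewner

end Literature.Probability.RandomPlanarGeometry

end
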